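import Summits.QuantumAdvantage.AdviceFreeQNC0.EliminationLogDegree
import HarnessLib

/-!
# Cell qa-qnc0 — the cross-team game of the `RingToElim` lines: `𝔽₄` bookkeeping and parity sums

Both registered lines (`product`, `tensor`) of the route crux `RingToElim` share the stub

  `stub_embed : CrossTeamHardPolylog → RingHardU`   ("a walk strategy of degree `≤ (log₂ n)^C` on
  `n = L + L'` bits aggregates block by block into a cross-team profile of cross-degree
  `≤ (log₂ min(L,L'))^{2C}` with the same win set"),

over the vocabulary `T4` (`𝔽₄` as pairs `(a,b) ↦ a + bω`), `t4add`, `tMulOmega`, `tOmegaPow`,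
`CrossDeg`, `crossWin`, `crossWinCount` (planner qa-qnc0-p1, line `tensor` by qa-qnc0-p2). This file
repeats that vocabulary VERBATIM and supplies the algebra the embedding needs:

* `tOmegaPow_eq_iterate` (`ω³ = 1`), `tOmegaPow_add`, `tOmegaPow_t4add` (linearity),
  `tOmegaPow_one_snd` (`Tr ω^m = [m ≢ 0 (3)]`), `win_iff` (`Tr(ω^m X) = 1 ↔ X ∉ {0, ω^{2m}}`);
* `t4sum` — `𝔽₄`-valued sums as coordinatewise parities, with `t4sum_split`, `t4sum_congr`,
  `t4sum_tOmegaPow` (linearity) and `hasDeg_parity` (a parity of degree-`≤ D` Boolean functions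
  has degree `≤ D`, from `hasDeg_xor`).

`CrossTeamEmbedding.lean` assembles `stub_embed` from these.
-/

namespace Summit.QuantumAdvantage.AdviceFreeQNC0

open Finset Literature.Computability.MetaComplexity Literature.Computability.MetaComplexity.Smolensky

/-! ### The vocabulary (verbatim from the registered lines) -/

/-- `𝔽₄` as pairs: `(a, b) ↦ a + b·ω`. -/
abbrev T4 := Bool × Bool

/-- addition in `𝔽₄`. -/
def t4add (p q : T4) : T4 := (xor p.1 q.1, xor p.2 q.2)

/-- multiplication by `ω`: `(a + bω)ω = b + (a + b)ω`. -/
def tMulOmega (p : T4) : T4 := (p.2, xor p.1 p.2)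

/-- multiplication by `ω^r`. -/
def tOmegaPow (r : ℕ) (p : T4) : T4 := tMulOmega^[r % 3] p

/-- cross-degree `≤ d`: for every own input, both coordinates are degree-`≤ d` functions of the
other block. -/
def CrossDeg {L L' : ℕ} (d : ℕ) (F : (Fin L → Bool) → (Fin L' → Bool) → T4) : Prop :=
  ∀ u, HasDeg (fun v => (F u v).1) d ∧ HasDeg (fun v => (F u v).2) d

/-- the referee: `X = Λ₀ + ω^{|u|}Λ₁ ∉ {0, ω^{2(c + |u| + |v|)}}`. -/
def crossWin {L L' : ℕ} (c : ℕ) (F₀ : (Fin L → Bool) → (Fin L' → Bool) → T4)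
    (F₁ : (Fin L' → Bool) → (Fin L → Bool) → T4) (u : Fin L → Bool) (v : Fin L' → Bool) : Bool :=
  let X := t4add (F₀ u v) (tOmegaPow (wt u) (F₁ v u))
  decide (X ≠ (false, false) ∧ X ≠ tOmegaPow (2 * (c + wt u + wt v)) (true, false))

/-- the number of won cells. -/
def crossWinCount {L L' : ℕ} (c : ℕ) (F₀ : (Fin L → Bool) → (Fin L' → Bool) → T4)
    (F₁ : (Fin L' → Bool) → (Fin L → Bool) → T4) : ℕ :=
  (univ.filter fun p : (Fin L → Bool) × (Fin L' → Bool) => crossWin c F₀ F₁ p.1 p.2 = true).card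

/-! ### `𝔽₄` bookkeeping -/

/-- `ω³ = 1`. -/
theorem tMulOmega_three (p : T4) : tMulOmega (tMulOmega (tMulOmega p)) = p := by
  obtain ⟨a, b⟩ := p; cases a <;> cases b <;> rfl

/-- Iterating `ω·` depends only on the exponent modulo `3`. -/
theorem iterate_tMulOmega_mod (m : ℕ) (p : T4) : tMulOmega^[m] p = tMulOmega^[m % 3] p := by
  have h3 : (tMulOmega^[3]) = id := by
    funext q
    simp only [Function.iterate_succ, Function.iterate_zero, Function.comp_apply, id_eq,
      CompTriple.comp_eq]
    exact tMulOmega_three q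
  conv_lhs => rw [← Nat.div_add_mod m 3, Function.iterate_add_apply, Function.iterate_mul, h3,
    Function.iterate_id]
  rfl

/-- `ω^r · p` is the `r`-fold application of `ω·`. -/
theorem tOmegaPow_eq_iterate (r : ℕ) (p : T4) : tOmegaPow r p = tMulOmega^[r] p := by
  unfold tOmegaPow
  rw [← iterate_tMulOmega_mod]

/-- `ω^{a+b} = ω^a ω^b`. -/
theorem tOmegaPow_add (a b : ℕ) (p : T4) : tOmegaPow (a + b) p = tOmegaPow a (tOmegaPow b p) := by
  rw [tOmegaPow_eq_iterate, tOmegaPow_eq_iterate, tOmegaPow_eq_iterate, Function.iterate_add_apply]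

/-- `ω·` is additive. -/
theorem tMulOmega_t4add (p q : T4) : tMulOmega (t4add p q) = t4add (tMulOmega p) (tMulOmega q) := by
  obtain ⟨a, b⟩ := p; obtain ⟨c, d⟩ := q
  cases a <;> cases b <;> cases c <;> cases d <;> rfl

/-- `ω^r ·` is additive. -/
theorem tOmegaPow_t4add (r : ℕ) (p q : T4) :
    tOmegaPow r (t4add p q) = t4add (tOmegaPow r p) (tOmegaPow r q) := by
  rw [tOmegaPow_eq_iterate, tOmegaPow_eq_iterate, tOmegaPow_eq_iterate]
  induction r with
  | zero => rfl
  | succ r ih => rw [Function.iterate_succ_apply', ih, tMulOmega_t4add, Function.iterate_succ_apply',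
      Function.iterate_succ_apply']

/-- `ω^r · 0 = 0`. -/
theorem tOmegaPow_zero_elt (r : ℕ) : tOmegaPow r (false, false) = (false, false) := by
  rw [tOmegaPow_eq_iterate]
  induction r with
  | zero => rfl
  | succ r ih => rw [Function.iterate_succ_apply', ih]; rfl

/-- `t4add` with `0`. -/
theorem t4add_zero_right (p : T4) : t4add p (false, false) = p := by
  obtain ⟨a, b⟩ := p; cases a <;> cases b <;> rfl

/-- Residues modulo `3`. -/
private theorem mod_three_cases (m : ℕ) : m % 3 = 0 ∨ m % 3 = 1 ∨ m % 3 = 2 := by omega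

/-- **`Tr ω^m = [m ≢ 0 (mod 3)]`**: the second coordinate of `ω^m`. -/
theorem tOmegaPow_one_snd (m : ℕ) : (tOmegaPow m (true, false)).2 = decide (m % 3 ≠ 0) := by
  unfold tOmegaPow
  rcases mod_three_cases m with h | h | h <;> rw [h] <;> decide

/-- **The referee in trace form**: `Tr(ω^m X) = 1 ↔ X ∉ {0, ω^{2m}}` (`ω^{2m} = ω^{−m}`). -/
theorem win_iff (m : ℕ) (X : T4) :
    (tOmegaPow m X).2 = true ↔ (X ≠ (false, false) ∧ X ≠ tOmegaPow (2 * m) (true, false)) := by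
  have h2 : (2 * m) % 3 = (2 * (m % 3)) % 3 := by omega
  unfold tOmegaPow
  rw [h2]
  rcases mod_three_cases m with h | h | h <;> rw [h] <;> revert X <;> decide

/-! ### `𝔽₄`-valued sums as parities -/

/-- The sum `Σ_{i ∈ s} f i` in `𝔽₄`, coordinatewise as parities. -/
def t4sum {ι : Type*} (s : Finset ι) (f : ι → T4) : T4 :=
  (decide ((s.filter fun i => (f i).1 = true).card % 2 = 1),
   decide ((s.filter fun i => (f i).2 = true).card % 2 = 1))

/-- The trace (second coordinate) of a sum is the parity of the traces. -/
theorem t4sum_snd {ι : Type*} (s : Finset ι) (f : ι → T4) :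
    (t4sum s f).2 = decide ((s.filter fun i => (f i).2 = true).card % 2 = 1) := rfl

/-- Sums agree when the summands agree on `s`. -/
theorem t4sum_congr {ι : Type*} (s : Finset ι) {f g : ι → T4} (h : ∀ i ∈ s, f i = g i) :
    t4sum s f = t4sum s g := by
  unfold t4sum
  rw [Finset.filter_congr (fun i hi => by rw [h i hi]),
    Finset.filter_congr (p := fun i => (f i).2 = true) (fun i hi => by rw [h i hi])]

/-- Parity of a sum of two counts. -/
private theorem decide_add_mod_two (a b : ℕ) :
    decide ((a + b) % 2 = 1) = xor (decide (a % 2 = 1)) (decide (b % 2 = 1)) := by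
  rcases Nat.mod_two_eq_zero_or_one a with ha | ha <;>
    rcases Nat.mod_two_eq_zero_or_one b with hb | hb <;>
      simp [ha, hb, Nat.add_mod]

/-- **Splitting a sum** along a predicate. -/
theorem t4sum_split {ι : Type*} (s : Finset ι) (p : ι → Prop) [DecidablePred p] (f : ι → T4) :
    t4sum s f = t4add (t4sum (s.filter p) f) (t4sum (s.filter fun i => ¬ p i) f) := by
  unfold t4sum t4add
  simp only
  rw [Finset.filter_filter, Finset.filter_filter, Finset.filter_filter, Finset.filter_filter]
  have key : ∀ q : ι → Prop, ∀ [DecidablePred q],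
      (s.filter q).card = (s.filter fun i => p i ∧ q i).card + (s.filter fun i => ¬ p i ∧ q i).card := by
    intro q _
    rw [← Finset.card_filter_add_card_filter_not (s := s.filter q) p, Finset.filter_filter,
      Finset.filter_filter]
    congr 1
    · congr 1; ext i; simp only [Finset.mem_filter]; tauto
    · congr 1; ext i; simp only [Finset.mem_filter]; tauto
  rw [key (fun i => (f i).1 = true), key (fun i => (f i).2 = true), decide_add_mod_two,
    decide_add_mod_two]

/-- The number of `i` with `a i ⊕ b i` has the parity of `#{a} + #{b}`. -/
private theorem card_filter_xor_mod_two {ι : Type*} (s : Finset ι) (a b : ι → Bool) :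
    (s.filter fun i => xor (a i) (b i) = true).card % 2 =
      ((s.filter fun i => a i = true).card + (s.filter fun i => b i = true).card) % 2 := by
  rw [card_filter, card_filter, card_filter, ← sum_add_distrib]
  have h : ∀ i ∈ s, ((if a i = true then 1 else 0) + (if b i = true then 1 else 0) : ℕ) =
      (if xor (a i) (b i) = true then 1 else 0) + 2 * (if (a i = true ∧ b i = true) then 1 else 0) := by
    intro i _
    cases a i <;> cases b i <;> simp
  rw [sum_congr rfl h, sum_add_distrib, ← mul_sum]
  omega

/-- `ω·` commutes with sums. -/
theorem t4sum_tMulOmega {ι : Type*} (s : Finset ι) (f : ι → T4) :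
    t4sum s (fun i => tMulOmega (f i)) = tMulOmega (t4sum s f) := by
  unfold t4sum tMulOmega
  simp only
  congr 1
  rw [Bool.eq_iff_iff]
  simp only [decide_eq_true_eq]
  rw [card_filter_xor_mod_two]
  rcases Nat.mod_two_eq_zero_or_one (s.filter fun i => (f i).1 = true).card with ha | ha <;>
    rcases Nat.mod_two_eq_zero_or_one (s.filter fun i => (f i).2 = true).card with hb | hb <;>
      simp [ha, hb, Nat.add_mod]

/-- **Linearity**: `ω^r ·` commutes with sums. -/
theorem t4sum_tOmegaPow {ι : Type*} (s : Finset ι) (r : ℕ) (f : ι → T4) :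
    t4sum s (fun i => tOmegaPow r (f i)) = tOmegaPow r (t4sum s f) := by
  simp only [tOmegaPow_eq_iterate]
  induction r with
  | zero => rfl
  | succ r ih =>
    simp only [Function.iterate_succ_apply']
    rw [← ih, ← t4sum_tMulOmega]

/-! ### Parities of low-degree Boolean functions are low-degree -/

variable {k : ℕ}

/-- The constant `false` has every degree. -/
theorem hasDeg_false (D : ℕ) : HasDeg (fun _ : Fin k → Bool => false) D := by
  unfold HasDeg
  have : (fun x : Fin k → Bool => if false = true then (1 : ZMod 2) else 0) = 0 := by
    funext x; simp
  rw [this]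
  exact Submodule.zero_mem _

/-- **Parity of degree-`≤ D` functions has degree `≤ D`** (iterated `hasDeg_xor`). -/
theorem hasDeg_parity {ι : Type*} (s : Finset ι) (f : ι → (Fin k → Bool) → Bool) {D : ℕ}
    (hf : ∀ i ∈ s, HasDeg (f i) D) :
    HasDeg (fun v => decide ((s.filter fun i => f i v = true).card % 2 = 1)) D := by
  classical
  induction s using Finset.induction_on with
  | empty =>
    have : (fun v : Fin k → Bool => decide (((∅ : Finset ι).filter fun i => f i v = true).card % 2 = 1)) =
        fun _ => false := by
      funext v; simp
    rw [this]
    exact hasDeg_false D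
  | insert a s ha ih =>
    have heq : (fun v : Fin k → Bool =>
          decide (((insert a s).filter fun i => f i v = true).card % 2 = 1)) =
        fun v => xor (f a v) (decide ((s.filter fun i => f i v = true).card % 2 = 1)) := by
      funext v
      rw [Finset.filter_insert]
      by_cases hfa : f a v = true
      · rw [if_pos hfa, Finset.card_insert_of_notMem (fun h => ha (Finset.mem_of_mem_filter a h)),
          hfa, decide_add_mod_two]
        cases decide ((s.filter fun i => f i v = true).card % 2 = 1) <;> rfl
      · rw [if_neg hfa, Bool.eq_false_iff.2 hfa, Bool.false_xor]
    rw [heq]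
    exact hasDeg_xor (hf a (Finset.mem_insert_self a s))
      (ih fun i hi => hf i (Finset.mem_insert_of_mem hi))

end Summit.QuantumAdvantage.AdviceFreeQNC0
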